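import Mathlib
import Summits.MatrixMultiplication.MatrixMultiplication.Theses.ShapeSubmodularity
import Summits.MatrixMultiplication.MatrixMultiplication.Theorems.ShapeSubmodularityShapeSubmodularCertificateReduction
import Summits.MatrixMultiplication.MatrixMultiplication.Theorems.ShapeSubmodularityPerfectAmortisation

/-!
# Crux `ShapeSubmodular` (stmt-MatrixMultiplication-15622) is equivalent to the summit `ω(ℂ) = 2`

Route `ShapeSubmodularity` files `X = SUBMOD ∧ E` with the deciding theorem
`Theses.ShapeSubmodularity.closes : ShapeSubmodular → PerfectAmortisation → MatrixMultiplication` and records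
that both conjuncts are necessary.  Since 2026-08-17 the second conjunct `E = PerfectAmortisation`
(`inf_k [ω(1,1,k) − k − 1] = 0`, Coppersmith 1982 / Lotti–Romani 1983) is a THEOREM of the tree
(`Theorems.PerfectAmortisation.perfectAmortisation_proof_shapeSubmodularity`, item stmt-10893, closed), and the
necessity direction `ω = 2 → SUBMOD` was landed by the c2 lead of this crux
(`Theorems.ShapeSubmodular.ShapeSubmodular_of_omega_eq_two`, via `α = 1`).  Putting the three together:

* `ShapeSubmodular_iff_MatrixMultiplication` — **the crux is kernel-equivalent to the summit statement**
  `MatrixMultiplication` (`ω(ℂ) = 2`); also as `ShapeSubmodular_iff_omega_eq_two` and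
  `ShapeSubmodular_iff_dualExponentAlpha_eq_one`;
* `coreNoCert_iff_MatrixMultiplication` — the ONE registered open stub `stub_coreExchange` of the crux's only line
  (`Cruxes/ShapeSubmodular/Lines/birth.lean`, RESHAPE 8: the unit exchange law on the certificate-free fat core)
  is likewise kernel-equivalent to `ω(ℂ) = 2` (through `ShapeSubmodular_iff_coreNoCert`, p156590), and so is the
  RESHAPE-4 core statement (`coreExchange_iff_MatrixMultiplication`, through `ShapeSubmodular_iff_coreExchange`,
  p150686);
* the route item that is the converse direction, BY NAME: `submodOfOmegaTwo_proof : SubmodOfOmegaTwo` (stmt-15145);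
  the forward direction with `E` as hypothesis is the route's `Assembly` (stmt-15149), which is `closes` itself.

Consequence for the line chain (lead c5): any proof of the residue stub is a proof of `ω = 2` and any refutation
of the crux is a proof of `ω > 2`; the crux carries no reduction of the summit any more, so no line of stubs
provable from known facts can close it (cf. the independence certificate `exists_darkPoint_shapeModel`, p158410).
No new definitions; axioms `propext`, `Classical.choice`, `Quot.sound` only.

REPAIR (2026-08-17T14:4xZ): route ShapeSubmodularity is CLOSED (superseded by CubicExchangeSplit) and its `closes` was
removed from the route file; the proof of `closes` is re-landed below as `submod_closes` so that this certificate
(`ShapeSubmodular ↔ MatrixMultiplication`, flagged `summit_equivalent` on item 15622) elaborates at head again.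
-/

set_option linter.dupNamespace false
-- (single-conjunct summit: the namespace repeats `MatrixMultiplication`)

namespace Summit.MatrixMultiplication.MatrixMultiplication.Theorems.ShapeSubmodular

open Summit.MatrixMultiplication.MatrixMultiplication.Theses.ShapeSubmodularity
open Literature.Computability.AlgebraicComplexity

/-- **`SUBMOD → E → ω(ℂ) = 2`** — the former deciding theorem `Theses.ShapeSubmodularity.closes` of route
ShapeSubmodularity, re-landed VERBATIM here (repair 2026-08-17T14:4xZ, planner-cstrat-…-15622-r1): the route was CLOSED
`superseded:route-MatrixMultiplication-CubicExchangeSplit` at 14:08:24Z and the gate removed `theorem closes` from the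
route file, which broke this file (and `…OfBorderLogSubmodular.lean`, `…ShapeSubmodularSplit.lean`) at tree head.
Proof: E at slack ε/8 rotated into the formats (k,1,1), (1,k,1); SUBMOD at that staircase pair (slack ε/4); flattening
`n^k·n^k ≤ R⟨n^k,n^k,n⟩` forces γ ≥ 2k; the meet exponent γ' is admissible for ⟨n,n,n⟩, so ω ≤ γ' < 2 + ε. [folklore] -/
theorem submod_closes : ShapeSubmodular → PerfectAmortisation → _root_.MatrixMultiplication := by
  intro hS hE
  -- transport of the rank along equalities of the three formats
  have congr3 : ∀ {k k' m m' l l' : ℕ}, k = k' → m = m' → l = l' →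
      Literature.Computability.AlgebraicComplexity.tensorRank
          (Literature.Computability.AlgebraicComplexity.matMulTensor ℂ k m l) =
        Literature.Computability.AlgebraicComplexity.tensorRank
          (Literature.Computability.AlgebraicComplexity.matMulTensor ℂ k' m' l') := by
    intro k k' m m' l l' hk hm hl
    subst hk; subst hm; subst hl; rfl
  -- flattening in exponent coordinates: an O(n^γ) bound on R⟨n^k, n^k, n^1⟩ forces 2k ≤ γ
  have flat : ∀ (k : ℕ) (γ : ℝ),
      (fun n : ℕ => (Literature.Computability.AlgebraicComplexity.tensorRank
        (Literature.Computability.AlgebraicComplexity.matMulTensor ℂ (n ^ k) (n ^ k) (n ^ 1)) : ℝ))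
        =O[Filter.atTop] (fun n : ℕ => (n : ℝ) ^ γ) → 2 * (k : ℝ) ≤ γ := by
    intro k γ hγ
    by_contra hlt
    rw [not_le] at hlt
    obtain ⟨C, hC⟩ := Asymptotics.isBigO_iff.1 hγ
    have hev : ∀ᶠ n : ℕ in Filter.atTop, (n : ℝ) ^ (2 * (k : ℝ) - γ) ≤ C := by
      filter_upwards [hC, Filter.eventually_gt_atTop 0] with n hn hn0
      have hn0' : (0 : ℝ) < n := Nat.cast_pos.2 hn0
      rw [Real.norm_of_nonneg (Nat.cast_nonneg _),
        Real.norm_of_nonneg (Real.rpow_nonneg (Nat.cast_nonneg _) _)] at hn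
      have hflat : n ^ k * n ^ k ≤ Literature.Computability.AlgebraicComplexity.tensorRank
          (Literature.Computability.AlgebraicComplexity.matMulTensor ℂ (n ^ k) (n ^ k) (n ^ 1)) := by
        haveI : NeZero (n ^ 1) := ⟨(pow_pos hn0 1).ne'⟩
        exact Literature.Computability.AlgebraicComplexity.mul_le_tensorRank_matMulTensor_left ℂ
          (n ^ k) (n ^ k) (n ^ 1)
      have hpow : (n : ℝ) ^ (2 * (k : ℝ)) = ((n ^ k * n ^ k : ℕ) : ℝ) := by
        rw [show (2 * (k : ℝ)) = ((2 * k : ℕ) : ℝ) by push_cast; ring, Real.rpow_natCast]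
        push_cast
        ring
      have hsq : (n : ℝ) ^ (2 * (k : ℝ)) ≤ C * (n : ℝ) ^ γ := by
        refine le_trans ?_ hn
        rw [hpow]
        exact_mod_cast hflat
      rw [Real.rpow_sub hn0', div_le_iff₀ (Real.rpow_pos_of_pos hn0' _)]
      exact hsq
    have hlim : Filter.Tendsto (fun n : ℕ => (n : ℝ) ^ (2 * (k : ℝ) - γ)) Filter.atTop Filter.atTop :=
      (tendsto_rpow_atTop (by linarith)).comp tendsto_natCast_atTop_atTop
    obtain ⟨n, hn₁, hn₂⟩ := (hev.and (hlim.eventually_gt_atTop C)).exists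
    exact absurd hn₁ (not_le.2 hn₂)
  -- ω ≤ 2: E at slack ε/8, rotated into the formats (k,1,1) and (1,k,1), then SUBMOD at slack ε/4
  have hle : Literature.Computability.AlgebraicComplexity.omega ℂ ≤ 2 := by
    refine le_of_forall_pos_lt_add fun ε hε => ?_
    obtain ⟨k, hk, hO⟩ := hE (ε / 8) (by positivity)
    have hk11 : (fun n : ℕ => (Literature.Computability.AlgebraicComplexity.tensorRank
        (Literature.Computability.AlgebraicComplexity.matMulTensor ℂ (n ^ k) (n ^ 1) (n ^ 1)) : ℝ))
        =O[Filter.atTop] (fun n : ℕ => (n : ℝ) ^ ((k : ℝ) + 1 + ε / 8)) := by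
      have hfun : (fun n : ℕ => (Literature.Computability.AlgebraicComplexity.tensorRank
          (Literature.Computability.AlgebraicComplexity.matMulTensor ℂ (n ^ k) (n ^ 1) (n ^ 1)) : ℝ)) =
          fun n : ℕ => (Literature.Computability.AlgebraicComplexity.tensorRank
            (Literature.Computability.AlgebraicComplexity.matMulTensor ℂ n n (n ^ k)) : ℝ) := by
        funext n
        rw [congr3 rfl (pow_one n) (pow_one n),
          Literature.Computability.AlgebraicComplexity.tensorRank_matMulTensor_rotate ℂ (n ^ k) n n]
      rw [hfun]
      exact hO
    have h1k1 : (fun n : ℕ => (Literature.Computability.AlgebraicComplexity.tensorRank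
        (Literature.Computability.AlgebraicComplexity.matMulTensor ℂ (n ^ 1) (n ^ k) (n ^ 1)) : ℝ))
        =O[Filter.atTop] (fun n : ℕ => (n : ℝ) ^ ((k : ℝ) + 1 + ε / 8)) := by
      have hfun : (fun n : ℕ => (Literature.Computability.AlgebraicComplexity.tensorRank
          (Literature.Computability.AlgebraicComplexity.matMulTensor ℂ (n ^ 1) (n ^ k) (n ^ 1)) : ℝ)) =
          fun n : ℕ => (Literature.Computability.AlgebraicComplexity.tensorRank
            (Literature.Computability.AlgebraicComplexity.matMulTensor ℂ n n (n ^ k)) : ℝ) := by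
        funext n
        rw [congr3 (pow_one n) rfl (pow_one n),
          Literature.Computability.AlgebraicComplexity.tensorRank_matMulTensor_rotate ℂ n (n ^ k) n,
          Literature.Computability.AlgebraicComplexity.tensorRank_matMulTensor_rotate ℂ (n ^ k) n n]
      rw [hfun]
      exact hO
    -- SUBMOD at p = (k,1,1), q = (1,k,1): join (k,k,1), meet (1,1,1)
    obtain ⟨γ, γ', hsum, hjoin, hmeet⟩ :=
      hS k 1 1 1 k 1 ((k : ℝ) + 1 + ε / 8) ((k : ℝ) + 1 + ε / 8) hk11 h1k1 (ε / 4) (by positivity)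
    rw [max_eq_left hk, max_eq_right hk, max_self] at hjoin
    rw [min_eq_right hk, min_eq_left hk, min_self] at hmeet
    -- flattening on the join: 2k ≤ γ
    have hγ : 2 * (k : ℝ) ≤ γ := flat k γ hjoin
    -- the meet is ⟨n,n,n⟩: γ' is an admissible exponent, so ω ≤ γ'
    have hγ' : Literature.Computability.AlgebraicComplexity.omega ℂ ≤ γ' := by
      have hmem : γ' ∈ Literature.Computability.AlgebraicComplexity.admissibleExponents ℂ := by
        have hfun : (fun n : ℕ => (Literature.Computability.AlgebraicComplexity.tensorRank
            (Literature.Computability.AlgebraicComplexity.matMulTensor ℂ n n n) : ℝ)) =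
            fun n : ℕ => (Literature.Computability.AlgebraicComplexity.tensorRank
              (Literature.Computability.AlgebraicComplexity.matMulTensor ℂ (n ^ 1) (n ^ 1) (n ^ 1)) : ℝ) := by
          funext n
          rw [congr3 (pow_one n) (pow_one n) (pow_one n)]
        show (fun n : ℕ => (Literature.Computability.AlgebraicComplexity.tensorRank
            (Literature.Computability.AlgebraicComplexity.matMulTensor ℂ n n n) : ℝ)) =O[Filter.atTop]
            fun n : ℕ => (n : ℝ) ^ γ'
        rw [hfun]
        exact hmeet
      exact csInf_le (Literature.Computability.AlgebraicComplexity.admissibleExponents_bddBelow ℂ) hmem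
    linarith
  exact (_root_.MatrixMultiplication_iff).2
    (le_antisymm hle (Literature.Computability.AlgebraicComplexity.omega_two_le ℂ))

/-- **`SUBMOD ⟹ ω(ℂ) = 2`**: the route's deciding theorem `closes` with its second hypothesis
`PerfectAmortisation` discharged by the landed proof of crux E (Coppersmith 1982 in the tree's dress).
[folklore] -/
theorem matrixMultiplication_of_ShapeSubmodular (hS : ShapeSubmodular) : _root_.MatrixMultiplication :=
  submod_closes hS PerfectAmortisation.perfectAmortisation_proof_shapeSubmodularity

/-- **`SUBMOD ⟹ ω(ℂ) = 2`**, exponent form. [folklore] -/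
theorem omega_eq_two_of_ShapeSubmodular (hS : ShapeSubmodular) : omega ℂ = 2 :=
  (_root_.MatrixMultiplication_iff).1 (matrixMultiplication_of_ShapeSubmodular hS)

/-- **The crux `ShapeSubmodular` is equivalent to the summit `MatrixMultiplication` (`ω(ℂ) = 2`).**
(`→`: `closes` + the proved crux E; `←`: `ShapeSubmodular_of_omega_eq_two`, the flattening function
`max(a+b, b+c, a+c)` being submodular.) [folklore] -/
theorem ShapeSubmodular_iff_MatrixMultiplication : Summit.MatrixMultiplication.MatrixMultiplication.Theses.ShapeSubmodularity.ShapeSubmodular ↔ _root_.MatrixMultiplication :=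
  ⟨matrixMultiplication_of_ShapeSubmodular,
    fun h => ShapeSubmodular_of_omega_eq_two ((_root_.MatrixMultiplication_iff).1 h)⟩

/-- `ShapeSubmodular ↔ ω(ℂ) = 2`. [folklore] -/
theorem ShapeSubmodular_iff_omega_eq_two : ShapeSubmodular ↔ omega ℂ = 2 :=
  ShapeSubmodular_iff_MatrixMultiplication.trans _root_.MatrixMultiplication_iff

/-- `ShapeSubmodular ↔ α(ℂ) = 1` (`α = dualExponentAlpha`, `α = 1 ↔ ω = 2` by `dualExponentAlpha_eq_one_iff`):
the fat core `α · median < min` of the line's residue stub is EMPTY exactly when the crux holds. [folklore] -/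
theorem ShapeSubmodular_iff_dualExponentAlpha_eq_one : ShapeSubmodular ↔ dualExponentAlpha ℂ = 1 :=
  ShapeSubmodular_iff_omega_eq_two.trans (dualExponentAlpha_eq_one_iff ℂ).symm

/-- Route item `SubmodOfOmegaTwo` (stmt-MatrixMultiplication-15145) BY NAME: `ω(ℂ) = 2 → SUBMOD`. [folklore] -/
theorem submodOfOmegaTwo_proof : SubmodOfOmegaTwo :=
  fun h => ShapeSubmodular_of_omega_eq_two ((_root_.MatrixMultiplication_iff).1 h)

/-- **The registered residue stub is summit-equivalent.**  The statement of `stub_coreExchange`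
(`Cruxes/ShapeSubmodular/Lines/birth.lean`, RESHAPE 8 — unit exchange on the certificate-free fat core, the only
`sorry` of the crux's only line) holds iff `ω(ℂ) = 2`. [folklore] -/
theorem coreNoCert_iff_MatrixMultiplication :
    (∀ a b c : ℕ, 1 ≤ a → 1 ≤ b → 1 ≤ c →
      Literature.Computability.AlgebraicComplexity.dualExponentAlpha ℂ * ((max (min a b) (min (max a b) c) : ℕ) : ℝ) < ((min a (min b c) : ℕ) : ℝ) →
      ¬ (∀ δ : ℝ, 0 < δ → ∃ k p₁ p₂ p₃ p₄ p₅ p₆ p₇ p₈ : ℕ, ∃ f₁ g₁ h₁ f₂ g₂ h₂ : ℕ, ∃ u₁ u₂ : ℝ,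
        1 ≤ k ∧ p₁ + p₂ + p₅ + p₆ ≤ k ∧ p₃ + p₄ + p₇ + p₈ ≤ k ∧
        k * a ≤ (p₁ + p₂) * (a + 1) + (p₃ + p₄) * a + f₁ ∧
        k * b ≤ p₁ * b + p₂ * c + p₃ * (b + 1) + p₄ * c + g₁ ∧
        k * c ≤ p₁ * c + p₂ * b + p₃ * c + p₄ * (b + 1) + h₁ ∧
        k * (a + 1) ≤ (p₅ + p₆) * (a + 1) + (p₇ + p₈) * a + f₂ ∧
        k * (b + 1) ≤ p₅ * b + p₆ * c + p₇ * (b + 1) + p₈ * c + g₂ ∧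
        k * c ≤ p₅ * c + p₆ * b + p₇ * c + p₈ * (b + 1) + h₂ ∧
        (fun n : ℕ => (Literature.Computability.AlgebraicComplexity.tensorRank (Literature.Computability.AlgebraicComplexity.matMulTensor ℂ (n ^ f₁) (n ^ g₁) (n ^ h₁)) : ℝ)) =O[Filter.atTop]
          (fun n : ℕ => (n : ℝ) ^ u₁) ∧
        (fun n : ℕ => (Literature.Computability.AlgebraicComplexity.tensorRank (Literature.Computability.AlgebraicComplexity.matMulTensor ℂ (n ^ f₂) (n ^ g₂) (n ^ h₂)) : ℝ)) =O[Filter.atTop]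
          (fun n : ℕ => (n : ℝ) ^ u₂) ∧
        u₁ + u₂ + (((p₁ + p₂ + p₅ + p₆) * (max (a + 1 + b) (max (b + c) (a + 1 + c))) +
            (p₃ + p₄ + p₇ + p₈) * (max (a + (b + 1)) (max (b + 1 + c) (a + c))) : ℕ) : ℝ)
          ≤ ((k * (max (a + 1 + b) (max (b + c) (a + 1 + c)) + max (a + (b + 1)) (max (b + 1 + c) (a + c))) : ℕ) : ℝ)
            + δ) →
      ∀ β β' : ℝ,
      (fun n : ℕ => (Literature.Computability.AlgebraicComplexity.tensorRank (Literature.Computability.AlgebraicComplexity.matMulTensor ℂ (n ^ (a + 1)) (n ^ b) (n ^ c)) : ℝ)) =O[Filter.atTop] (fun n : ℕ => (n : ℝ) ^ β) →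
      (fun n : ℕ => (Literature.Computability.AlgebraicComplexity.tensorRank (Literature.Computability.AlgebraicComplexity.matMulTensor ℂ (n ^ a) (n ^ (b + 1)) (n ^ c)) : ℝ)) =O[Filter.atTop] (fun n : ℕ => (n : ℝ) ^ β') →
      ∀ ε : ℝ, 0 < ε → ∃ γ γ' : ℝ, γ + γ' ≤ β + β' + ε ∧
        (fun n : ℕ => (Literature.Computability.AlgebraicComplexity.tensorRank (Literature.Computability.AlgebraicComplexity.matMulTensor ℂ (n ^ (a + 1)) (n ^ (b + 1)) (n ^ c)) : ℝ)) =O[Filter.atTop] (fun n : ℕ => (n : ℝ) ^ γ) ∧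
        (fun n : ℕ => (Literature.Computability.AlgebraicComplexity.tensorRank (Literature.Computability.AlgebraicComplexity.matMulTensor ℂ (n ^ a) (n ^ b) (n ^ c)) : ℝ)) =O[Filter.atTop] (fun n : ℕ => (n : ℝ) ^ γ')) ↔
    _root_.MatrixMultiplication :=
  ShapeSubmodular_iff_coreNoCert.symm.trans ShapeSubmodular_iff_MatrixMultiplication

/-- The RESHAPE-4 core statement (unit exchange on the whole fat core `α · median < min`, hypothesis-free) is
summit-equivalent as well (through `ShapeSubmodular_iff_coreExchange`, p150686). [folklore] -/
theorem coreExchange_iff_MatrixMultiplication :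
    (∀ a b c : ℕ, 1 ≤ a → 1 ≤ b → 1 ≤ c →
      Literature.Computability.AlgebraicComplexity.dualExponentAlpha ℂ *
          ((max (min a b) (min (max a b) c) : ℕ) : ℝ) < ((min a (min b c) : ℕ) : ℝ) →
      ∀ β β' : ℝ,
      (fun n : ℕ => (Literature.Computability.AlgebraicComplexity.tensorRank
        (Literature.Computability.AlgebraicComplexity.matMulTensor ℂ (n ^ (a + 1)) (n ^ b) (n ^ c)) : ℝ))
          =O[Filter.atTop] (fun n : ℕ => (n : ℝ) ^ β) →
      (fun n : ℕ => (Literature.Computability.AlgebraicComplexity.tensorRank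
        (Literature.Computability.AlgebraicComplexity.matMulTensor ℂ (n ^ a) (n ^ (b + 1)) (n ^ c)) : ℝ))
          =O[Filter.atTop] (fun n : ℕ => (n : ℝ) ^ β') →
      ∀ ε : ℝ, 0 < ε → ∃ γ γ' : ℝ, γ + γ' ≤ β + β' + ε ∧
        (fun n : ℕ => (Literature.Computability.AlgebraicComplexity.tensorRank
          (Literature.Computability.AlgebraicComplexity.matMulTensor ℂ
            (n ^ (a + 1)) (n ^ (b + 1)) (n ^ c)) : ℝ))
            =O[Filter.atTop] (fun n : ℕ => (n : ℝ) ^ γ) ∧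
        (fun n : ℕ => (Literature.Computability.AlgebraicComplexity.tensorRank
          (Literature.Computability.AlgebraicComplexity.matMulTensor ℂ (n ^ a) (n ^ b) (n ^ c)) : ℝ))
            =O[Filter.atTop] (fun n : ℕ => (n : ℝ) ^ γ')) ↔
    _root_.MatrixMultiplication :=
  ShapeSubmodular_iff_coreExchange.symm.trans ShapeSubmodular_iff_MatrixMultiplication

end Summit.MatrixMultiplication.MatrixMultiplication.Theorems.ShapeSubmodular
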